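import Mathlib
import HarnessLib
import Summits.ValiantsHypothesis.ValiantsHypothesis.Theses.MonotoneRestoration
import Literature.Computability.AlgebraicComplexity.ArithCircuit
import Literature.Computability.AlgebraicComplexity.ArithCircuitProofs
import Literature.Computability.AlgebraicComplexity.MonotoneStructure
import Literature.Computability.AlgebraicComplexity.PermanentIrreducible
import Literature.ModelTheory.FiniteModelTheory.CkEquiv
import Summits.ValiantsHypothesis.ValiantsHypothesis.Theorems.MonotoneRestorationMonotoneRestorationQPCosetCount
import Summits.ValiantsHypothesis.ValiantsHypothesis.Theorems.MonotoneRestorationMonotoneRestorationQPSymmetricLB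
import Summits.ValiantsHypothesis.ValiantsHypothesis.Theorems.MonotoneRestorationMonotoneRestorationQPSupportSymmetrisation
import Summits.ValiantsHypothesis.ValiantsHypothesis.Theorems.MonotoneRestorationMonotoneRestorationQPSparseRegime
import Summits.ValiantsHypothesis.ValiantsHypothesis.Theorems.MonotoneRestorationMonotoneRestorationQPBeta
import Literature.Computability.AlgebraicComplexity.SymmetricArithCircuit
import Literature.Computability.AlgebraicComplexity.DawarWilsenach2025Proofs
import Literature.GroupTheory.PermutationGroups.SmallIndexSubgroups
import Summits.ValiantsHypothesis.ValiantsHypothesis.Theorems.MonotoneRestorationQP.Negative.LoadBearing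
import Summits.ValiantsHypothesis.ValiantsHypothesis.Theorems.MonotoneRestorationMonotoneRestorationQPPermSupportCount
import Summits.ValiantsHypothesis.ValiantsHypothesis.Theorems.MonotoneRestorationMonotoneRestorationQPGateSupport

/-! TTRL-lite variant V19175 of stmt-ValiantsHypothesis-15886

Target `stub_gateSupport`, move `specialise` (`fix_nat:n=9`, the first non-vacuous size): in a
`Sym_9`-symmetric labelled arithmetic circuit with fewer than `C(9, k)` gates (`1 ≤ k`, `4k ≤ 9`),
every gate `g` has a set `X` of fewer than `k` indices such that every EVEN permutation fixing `X`
pointwise extends to a circuit automorphism fixing `g`. Immediate from the tree's general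
`stub_gateSupport` (gate-stabiliser index `≤ |G| < C(n,k)`, then Dixon–Mortimer 5.2B) at `n := 9`.
-/

-- `Summit.ValiantsHypothesis.ValiantsHypothesis.…` is the tree's mandated single-conjunct layout
-- (Sub = Summit), so the duplicated namespace component is intended.
set_option linter.dupNamespace false

namespace Summit.ValiantsHypothesis.ValiantsHypothesis.Theorems

open Summit.ValiantsHypothesis.ValiantsHypothesis.Theses.MonotoneRestoration
open Literature.Computability.AlgebraicComplexity

/-- **TTRL-lite variant V19175 of `stub_gateSupport`** (`n := 9`, support theorem in
gate-stabiliser form). In a `Sym_9`-symmetric labelled circuit with fewer than `C(9,k)` gates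
(`1 ≤ k`, `4k ≤ 9`), every gate `g` admits a set `X` of fewer than `k` indices such that every EVEN
permutation fixing `X` pointwise extends to an automorphism fixing `g`; the `n := 9` instance of the
tree's `stub_gateSupport`. [cite: DawarWilsenach2025, §6 (support theorem); DixonMortimer1996, Thm 5.2B] -/
theorem stub_gateSupport_var19175 :
    ∀ (K : Type) (G : Type) [Fintype G] (C : LabelledArithCircuit K (Fin 9 × Fin 9) Unit G)
      (hC : C.IsSymmetric (Equiv.Perm (Fin 9))) (k : ℕ) (hn : 8 < 9) (hk : 1 ≤ k) (h4k : 4 * k ≤ 9)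
      (hcard : Fintype.card G < (9).choose k) (g : G), ∃ X : Finset (Fin 9), X.card < k ∧
        ∀ ρ : Equiv.Perm (Fin 9), (∀ x ∈ X, ρ x = x) → Equiv.Perm.sign ρ = 1 →
          ∃ π : Equiv.Perm G, C.IsAutomorphismExtending ρ π ∧ π g = g :=
  fun _K _G _ C hC _k hn hk h4k hcard g => stub_gateSupport C hC hn hk h4k hcard g

end Summit.ValiantsHypothesis.ValiantsHypothesis.Theorems
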